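import Summits.CriticalPhenomena.Ising3DConformalLimit.Theorems.AnomalousForcesInteractionGaussianLimitIsFreeSphereCovariance
import Summits.CriticalPhenomena.Ising3DConformalLimit.Theorems.AnomalousForcesInteractionGaussianLimitIsFreeBridgeFromMarkovInheritance
import Literature.MathematicalPhysics.QuantumLattice.BallSpecification
import Literature.MathematicalPhysics.QuantumLattice.ShellToGermMarkov
import Literature.Probability.Independence.BlackNoiseCriterion
import HarnessLib

/-!
# Crux `GaussianLimitIsFree` (item stmt-CriticalPhenomena-2601), line `registered` (v10, lead c4):
# the `L²` decoupling inequality across the unit sphere — the minimal Markov input of the rigidity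

THEOREM-ONLY file (`--supports stmt-CriticalPhenomena-2601`).  The landed rigidity theorem
`stub_gaussMarkovRigidity` (…GermRigidity.lean, p161394) consumes the germ-Markov property (K) of the
realised Gaussian law at the unit ball only through ONE inequality (part 1 of its glue,
`abs_integral_mul_le_of_condIndepCondExp`): for `w` supported in the open unit ball and `v` supported
off a neighbourhood of the closed unit ball,

  `|E[ω(w) ω(v)]| ≤ ‖E[ω(w) | 𝒜((∂B)^ε)]‖_{L²} · ‖ω(v)‖_{L²}`        (D_ε)

with `𝒜((∂B)^ε) = fieldSigma (thickening ε (sphere 0 1))` the events of the `ε`-collar of the sphere.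
This file isolates (D) as the interface between the lattice and the rigidity:

* `integral_condExp_sq_mono` — `m ≤ m'` ⇒ `∫ E[X|m]² ≤ ∫ E[X|m']²` (tower + `L²`-contractivity).
* `CondIndepCondExp.sup_self_right` — if `m'` splits `m₁`, `m₂` then `m'` splits `m₁`, `m' ∨ m₂`
  (Rozanov 1982 Ch. 2 §1.1, (1.1) ⇔ (1.4), from the Literature lemma
  `CondIndepCondExp.condExp_indicator_ae_eq_sup`).
* `sphereDecoupling_of_germSplitting` — (K) at the unit ball ⇒ (D_ε) for every `ε > 0`.
* `sphereDecoupling_of_shellSplitting` — the THICK-SHELL Markov property at the unit ball (the shape of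
  the lattice theorem `Theorems.stub_thickShellMarkov` / Literature
  `condIndepCondExp_shell_spinFieldLaw_isingMeasure`: the open shell `B(0,1+ε) ∖ B̄(0,1)` splits the
  events of `B(0,1)` from the events off `B̄(0, 1+ε/2)`) ⇒ (D_ε).
* `twoPoint_eq_zero_of_sphereDecoupling` — (D) for all small `ε` + Gaussian + Riesz covariance
  `A‖x−y‖^{-2Δ}` (`1/2 < Δ ≤ 1`) ⇒ `E[ω(w)ω(v)] = 0` for the radial `w` with Riesz potential vanishing on
  the sphere and every `v` supported off the closed ball (same proof as `twoPoint_eq_zero_of_germMarkov_ball`).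
* `delta_eq_half_of_sphereDecoupling` — hence `Δ = 1/2` for a Gaussian law with moment densities
  `(√A)ⁿ·W_Δ`, `1/2 ≤ Δ ≤ 1`, satisfying (D) (same assembly as `stub_gaussMarkovRigidity`: far field +
  radial shell pair).

So the crux needs from the lattice EXACTLY (D) for the (hypothetical) Gaussian realised limit law; (K),
Rozanov's collar form (R) and the thick-shell form all imply it (this file and
`…GaussianLimitIsFreeReductions.lean`).

References: Yu. A. Rozanov, *Markov Random Fields* (1982), Ch. 2 §1.1, §1.3, Ch. 3 §2.3; L. D. Pitt,
ARMA 43 (1971); S. Kotani, LNM 330 (1973) Thm 2.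
-/

noncomputable section

namespace Summit.CriticalPhenomena.Ising3DConformalLimit.Cruxes.GaussianLimitIsFree.Birth

open MeasureTheory Filter Set
open scoped ProbabilityTheory Topology ENNReal
open Literature.MathematicalPhysics.QuantumLattice

/-! ### Two measure-theoretic lemmas -/

section MeasureTheory

variable {Ω : Type*}

/-- **Monotonicity of the `L²` norm of conditional expectations in the σ-algebra**: for
`m ≤ m' ≤ mΩ` and `X ∈ L²`, `∫ E[X|m]² ≤ ∫ E[X|m']²` (tower property `E[X|m] = E[E[X|m']|m]` and
`L²`-contractivity of `E[·|m]`). [folklore] -/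
theorem integral_condExp_sq_mono {m m' mΩ : MeasurableSpace Ω} {μ : Measure Ω} [IsFiniteMeasure μ]
    (hmm' : m ≤ m') (hm' : m' ≤ mΩ) {X : Ω → ℝ} (hX : MemLp X 2 μ) :
    ∫ ω, (μ[X | m]) ω ^ 2 ∂μ ≤ ∫ ω, (μ[X | m']) ω ^ 2 ∂μ := by
  have hm : m ≤ mΩ := hmm'.trans hm'
  have htower : μ[μ[X | m'] | m] =ᵐ[μ] μ[X | m] := condExp_condExp_of_le hmm' hm'
  have hY : MemLp (μ[X | m']) 2 μ := hX.condExp one_le_two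
  calc ∫ ω, (μ[X | m]) ω ^ 2 ∂μ = ∫ ω, (μ[μ[X | m'] | m]) ω ^ 2 ∂μ := by
        refine integral_congr_ae ?_
        filter_upwards [htower] with ω hω
        rw [hω]
    _ ≤ ∫ ω, (μ[X | m']) ω ^ 2 ∂μ := Literature.Probability.Independence.integral_condExp_sq_le hm hY

/-- **Splitting absorbs the splitting σ-algebra into one side**: if `m'` splits `m₁` and `m₂` under the
finite measure `μ` (all sub-σ-algebras of `mΩ`), then `m'` splits `m₁` and `m' ∨ m₂` (Rozanov 1982,
Ch. 2 §1.1, (1.1) ⇔ (1.4): for `s ∈ m₁`, `μ⟦s | m'⟧` is a version of `μ⟦s | m' ∨ m₂⟧`, whence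
`μ⟦s ∩ t | m'⟧ = E[𝟙_t μ⟦s | m'⟧ | m'] = μ⟦s | m'⟧ μ⟦t | m'⟧` for `t ∈ m' ∨ m₂`).
[cite: Rozanov1982, Ch. 2 §1.1 (1.1)–(1.4)] -/
theorem CondIndepCondExp.sup_self_right {m' m₁ m₂ mΩ : MeasurableSpace Ω} {μ : Measure Ω}
    [IsFiniteMeasure μ] (hm' : m' ≤ mΩ) (hm₁ : m₁ ≤ mΩ) (hm₂ : m₂ ≤ mΩ)
    (h : CondIndepCondExp m' m₁ m₂ μ) :
    CondIndepCondExp m' m₁ (m' ⊔ m₂) μ := by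
  intro s t hs ht
  have hsup : m' ⊔ m₂ ≤ mΩ := sup_le hm' hm₂
  have hsΩ : MeasurableSet s := hm₁ s hs
  have htΩ : MeasurableSet t := hsup t ht
  -- the indicator functions
  set fs : Ω → ℝ := s.indicator fun _ => (1 : ℝ) with hfs
  set ft : Ω → ℝ := t.indicator fun _ => (1 : ℝ) with hft
  have hfs_int : Integrable fs μ := (integrable_const 1).indicator hsΩ
  have hft_int : Integrable ft μ := (integrable_const 1).indicator htΩ
  have hft_sm : StronglyMeasurable[m' ⊔ m₂] ft :=
    (stronglyMeasurable_const (b := (1 : ℝ))).indicator ht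
  have hft_bdd : ∀ ω, ‖ft ω‖ ≤ 1 := fun ω => by
    by_cases hω : ω ∈ t <;> simp [hft, hω]
  have hprod : (s ∩ t).indicator (fun _ => (1 : ℝ)) = fun ω => ft ω * fs ω := by
    funext ω
    by_cases hωs : ω ∈ s <;> by_cases hωt : ω ∈ t <;> simp [hfs, hft, hωs, hωt, Set.indicator]
  have hft_asm : AEStronglyMeasurable ft μ := (hft_sm.mono hsup).aestronglyMeasurable
  -- Rozanov: `μ⟦s | m'⟧` is a version of `μ⟦s | m' ∨ m₂⟧`
  have hver : μ[fs | m'] =ᵐ[μ] μ[fs | m' ⊔ m₂] := h.condExp_indicator_ae_eq_sup hm' hm₁ hm₂ hs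
  -- integrability of the products
  have hint0 : Integrable (fun ω => ft ω * fs ω) μ := by
    have : Integrable ((s ∩ t).indicator fun _ => (1 : ℝ)) μ := (integrable_const 1).indicator (hsΩ.inter htΩ)
    rwa [hprod] at this
  have hint1 : Integrable (fun ω => ft ω * (μ[fs | m' ⊔ m₂]) ω) μ :=
    integrable_condExp.bdd_mul hft_asm (Eventually.of_forall hft_bdd)
  have hint2 : Integrable (fun ω => ft ω * (μ[fs | m']) ω) μ :=
    integrable_condExp.bdd_mul hft_asm (Eventually.of_forall hft_bdd)
  -- the chain of a.e. identities
  have e0 : μ[(s ∩ t).indicator fun _ => (1 : ℝ) | m'] = μ[fun ω => ft ω * fs ω | m'] := by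
    rw [hprod]
  have e1 : μ[fun ω => ft ω * fs ω | m'] =ᵐ[μ] μ[μ[fun ω => ft ω * fs ω | m' ⊔ m₂] | m'] :=
    (condExp_condExp_of_le (le_sup_left : m' ≤ m' ⊔ m₂) hsup).symm
  have e2 : μ[fun ω => ft ω * fs ω | m' ⊔ m₂] =ᵐ[μ] fun ω => ft ω * (μ[fs | m' ⊔ m₂]) ω :=
    condExp_mul_of_stronglyMeasurable_left hft_sm hint0 hfs_int
  have e3 : (fun ω => ft ω * (μ[fs | m' ⊔ m₂]) ω) =ᵐ[μ] fun ω => ft ω * (μ[fs | m']) ω := by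
    filter_upwards [hver] with ω hω
    rw [hω]
  have e4 : μ[fun ω => ft ω * (μ[fs | m']) ω | m'] =ᵐ[μ] μ[ft | m'] * μ[fs | m'] :=
    condExp_mul_of_stronglyMeasurable_right stronglyMeasurable_condExp hint2 hft_int
  calc μ[(s ∩ t).indicator fun _ => (1 : ℝ) | m']
      = μ[fun ω => ft ω * fs ω | m'] := e0
    _ =ᵐ[μ] μ[μ[fun ω => ft ω * fs ω | m' ⊔ m₂] | m'] := e1
    _ =ᵐ[μ] μ[fun ω => ft ω * (μ[fs | m']) ω | m'] := condExp_congr_ae (e2.trans e3)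
    _ =ᵐ[μ] μ[ft | m'] * μ[fs | m'] := e4
    _ = μ[fs | m'] * μ[ft | m'] := mul_comm _ _

end MeasureTheory

/-! ### The decoupling inequality (D) across the unit sphere from the Markov forms -/

section Field

open scoped SchwartzMap

/-- The open shell `B(0, 1+ε) ∖ B̄(0, 1)` lies in the `ε`-collar of the unit sphere. [folklore] -/
theorem shell_subset_thickening_sphere (ε : ℝ) :
    Metric.ball (0 : EuclideanSpace ℝ (Fin 3)) (1 + ε) \ Metric.closedBall (0 : EuclideanSpace ℝ (Fin 3)) 1 ⊆
      Metric.thickening ε (Metric.sphere (0 : EuclideanSpace ℝ (Fin 3)) 1) := by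
  rintro x ⟨hx1, hx2⟩
  rw [Metric.mem_ball, dist_zero_right] at hx1
  rw [Metric.mem_closedBall, dist_zero_right, not_le] at hx2
  have hx0 : x ≠ 0 := fun h => by
    rw [h, norm_zero] at hx2
    linarith
  rw [Metric.mem_thickening_iff]
  refine ⟨‖x‖⁻¹ • x, ?_, ?_⟩
  · rw [mem_sphere_zero_iff_norm, norm_smul, norm_inv, norm_norm, inv_mul_cancel₀ (norm_ne_zero_iff.2 hx0)]
  · rw [dist_eq_norm, CollarCutoff.norm_sub_norm_inv_smul hx0, abs_of_pos (by linarith)]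
    linarith

/-- **(K) ⇒ (D).**  If the germ σ-algebra of the unit sphere splits the germ σ-algebras of the closed unit
ball and of the complement of the open unit ball under the finite measure `μ` (Kotani's Def. 1 /
Rozanov's (3.14) at `ball 0 1`), then for `w` supported in the open ball, `v` supported off the closed
ball, both evaluations in `L²`, and every `ε > 0`:
`|E[ω(w)ω(v)]| ≤ ‖E[ω(w) | 𝒜((∂B)^ε)]‖₂ ‖ω(v)‖₂` (covariance bound of a splitting, then
`𝒜₊(∂B) ≤ 𝒜((∂B)^ε)`). [cite: Rozanov1982, Ch. 2 §1.1 (1.1)–(1.3)] -/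
theorem sphereDecoupling_of_germSplitting
    {μ : Measure (FieldConfig (EuclideanSpace ℝ (Fin 3)))} [IsFiniteMeasure μ]
    (hK : CondIndepCondExp (germSigma (frontier (Metric.ball (0 : EuclideanSpace ℝ (Fin 3)) 1)))
      (germSigma (closure (Metric.ball (0 : EuclideanSpace ℝ (Fin 3)) 1)))
      (germSigma (Metric.ball (0 : EuclideanSpace ℝ (Fin 3)) 1)ᶜ) μ)
    {ε : ℝ} (hε : 0 < ε) {w v : 𝓢((EuclideanSpace ℝ (Fin 3)), ℝ)}
    (hw : tsupport ⇑w ⊆ Metric.ball (0 : EuclideanSpace ℝ (Fin 3)) 1)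
    (hv : tsupport ⇑v ⊆ (Metric.closedBall (0 : EuclideanSpace ℝ (Fin 3)) 1)ᶜ)
    (hX2 : MemLp (fun ω : FieldConfig (EuclideanSpace ℝ (Fin 3)) => ω w) 2 μ)
    (hY2 : MemLp (fun ω : FieldConfig (EuclideanSpace ℝ (Fin 3)) => ω v) 2 μ) :
    |∫ ω, ω w * ω v ∂μ| ≤
      Real.sqrt (∫ ω, (μ[(fun ω : FieldConfig (EuclideanSpace ℝ (Fin 3)) => ω w) |
        fieldSigma (Metric.thickening ε (Metric.sphere (0 : EuclideanSpace ℝ (Fin 3)) 1))]) ω ^ 2 ∂μ) *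
      Real.sqrt (∫ ω, (ω v) ^ 2 ∂μ) := by
  have hfr : frontier (Metric.ball (0 : (EuclideanSpace ℝ (Fin 3))) 1) = Metric.sphere 0 1 :=
    frontier_ball (0 : (EuclideanSpace ℝ (Fin 3))) one_ne_zero
  have hcl : closure (Metric.ball (0 : (EuclideanSpace ℝ (Fin 3))) 1) = Metric.closedBall 0 1 :=
    closure_ball (0 : (EuclideanSpace ℝ (Fin 3))) one_ne_zero
  have hfr_sub : frontier (Metric.ball (0 : (EuclideanSpace ℝ (Fin 3))) 1) ⊆ (Metric.ball (0 : (EuclideanSpace ℝ (Fin 3))) 1)ᶜ := by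
    rw [Metric.isOpen_ball.frontier_eq]
    exact fun x hx => hx.2
  have hle : germSigma (frontier (Metric.ball (0 : (EuclideanSpace ℝ (Fin 3))) 1)) ≤
      germSigma (Metric.ball (0 : (EuclideanSpace ℝ (Fin 3))) 1)ᶜ := germSigma_mono hfr_sub
  have hXm : Measurable[germSigma (closure (Metric.ball (0 : (EuclideanSpace ℝ (Fin 3))) 1))]
      (fun ω : FieldConfig (EuclideanSpace ℝ (Fin 3)) => ω w) :=
    (measurable_eval_fieldSigma hw).mono
      ((fieldSigma_mono subset_closure).trans (fieldSigma_le_germSigma _)) le_rfl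
  have hv' : tsupport ⇑v ⊆ (closure (Metric.ball (0 : (EuclideanSpace ℝ (Fin 3))) 1))ᶜ := by rwa [hcl]
  have hYm : Measurable[germSigma (Metric.ball (0 : (EuclideanSpace ℝ (Fin 3))) 1)ᶜ]
      (fun ω : FieldConfig (EuclideanSpace ℝ (Fin 3)) => ω v) :=
    (measurable_eval_fieldSigma hv').mono
      ((fieldSigma_mono (Set.compl_subset_compl.2 subset_closure)).trans (fieldSigma_le_germSigma _)) le_rfl
  have hbound := abs_integral_mul_le_of_condIndepCondExp (germSigma_le _) (germSigma_le _)
    (germSigma_le _) hle hK hXm.stronglyMeasurable.aestronglyMeasurable hYm.stronglyMeasurable hX2 hY2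
  have hGle : germSigma (frontier (Metric.ball (0 : (EuclideanSpace ℝ (Fin 3))) 1)) ≤
      fieldSigma (Metric.thickening ε (Metric.sphere (0 : (EuclideanSpace ℝ (Fin 3))) 1)) := by
    rw [hfr]
    exact germSigma_le_fieldSigma_thickening _ hε
  have hmono := integral_condExp_sq_mono hGle (fieldSigma_le _) hX2
  exact hbound.trans (mul_le_mul_of_nonneg_right (Real.sqrt_le_sqrt hmono) (Real.sqrt_nonneg _))

/-- **Thick shell ⇒ (D).**  If, under the finite measure `μ`, the events of the open shell
`B(0, 1+ε) ∖ B̄(0, 1)` split the events of the open unit ball from the events off `B̄(0, 1 + ε/2)`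
(`CondIndepCondExp` of the `extEvents` σ-algebras — verbatim the shape of the lattice theorem
`Theorems.stub_thickShellMarkov` at `c = 0`, `r = 1`), then for `w` supported in the open unit ball and
`v` supported off `B̄(0, 1 + ε)`, both evaluations in `L²`:
`|E[ω(w)ω(v)]| ≤ ‖E[ω(w) | 𝒜((∂B)^ε)]‖₂ ‖ω(v)‖₂` (the shell σ-algebra also splits the ball from
shell ∨ far exterior, `CondIndepCondExp.sup_self_right`; covariance bound; the shell lies in the
`ε`-collar of the sphere). [cite: Rozanov1982, Ch. 2 §1.1 (1.1)–(1.4)] -/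
theorem sphereDecoupling_of_shellSplitting
    {μ : Measure (FieldConfig (EuclideanSpace ℝ (Fin 3)))} [IsFiniteMeasure μ] {ε : ℝ} (hε : 0 ≤ ε)
    (hS : CondIndepCondExp
      (extEvents (Metric.ball (0 : EuclideanSpace ℝ (Fin 3)) (1 + ε) \ Metric.closedBall (0 : EuclideanSpace ℝ (Fin 3)) 1))
      (extEvents (Metric.ball (0 : EuclideanSpace ℝ (Fin 3)) 1))
      (extEvents (Metric.closedBall (0 : EuclideanSpace ℝ (Fin 3)) (1 + ε / 2))ᶜ) μ)
    {w v : 𝓢((EuclideanSpace ℝ (Fin 3)), ℝ)}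
    (hw : tsupport ⇑w ⊆ Metric.ball (0 : EuclideanSpace ℝ (Fin 3)) 1)
    (hv : tsupport ⇑v ⊆ (Metric.closedBall (0 : EuclideanSpace ℝ (Fin 3)) (1 + ε))ᶜ)
    (hX2 : MemLp (fun ω : FieldConfig (EuclideanSpace ℝ (Fin 3)) => ω w) 2 μ)
    (hY2 : MemLp (fun ω : FieldConfig (EuclideanSpace ℝ (Fin 3)) => ω v) 2 μ) :
    |∫ ω, ω w * ω v ∂μ| ≤
      Real.sqrt (∫ ω, (μ[(fun ω : FieldConfig (EuclideanSpace ℝ (Fin 3)) => ω w) |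
        fieldSigma (Metric.thickening ε (Metric.sphere (0 : EuclideanSpace ℝ (Fin 3)) 1))]) ω ^ 2 ∂μ) *
      Real.sqrt (∫ ω, (ω v) ^ 2 ∂μ) := by
  set G : MeasurableSpace (FieldConfig (EuclideanSpace ℝ (Fin 3))) :=
    extEvents (Metric.ball (0 : EuclideanSpace ℝ (Fin 3)) (1 + ε) \ Metric.closedBall (0 : EuclideanSpace ℝ (Fin 3)) 1)
    with hGdef
  set X : MeasurableSpace (FieldConfig (EuclideanSpace ℝ (Fin 3))) :=
    extEvents (Metric.ball (0 : EuclideanSpace ℝ (Fin 3)) 1) with hXdef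
  set Y : MeasurableSpace (FieldConfig (EuclideanSpace ℝ (Fin 3))) :=
    extEvents (Metric.closedBall (0 : EuclideanSpace ℝ (Fin 3)) (1 + ε / 2))ᶜ with hYdef
  have hGle0 : G ≤ FieldConfig.instMeasurableSpace := extEvents_le _
  have hXle0 : X ≤ FieldConfig.instMeasurableSpace := extEvents_le _
  have hYle0 : Y ≤ FieldConfig.instMeasurableSpace := extEvents_le _
  have h' : CondIndepCondExp G X (G ⊔ Y) μ := CondIndepCondExp.sup_self_right hGle0 hXle0 hYle0 hS
  have hXm : Measurable[X] (fun ω : FieldConfig (EuclideanSpace ℝ (Fin 3)) => ω w) :=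
    measurable_eval_of_tsupport_subset hw
  have hv' : tsupport ⇑v ⊆ (Metric.closedBall (0 : EuclideanSpace ℝ (Fin 3)) (1 + ε / 2))ᶜ := by
    exact hv.trans (Set.compl_subset_compl.2 (Metric.closedBall_subset_closedBall (by linarith)))
  have hYm : Measurable[G ⊔ Y] (fun ω : FieldConfig (EuclideanSpace ℝ (Fin 3)) => ω v) :=
    (measurable_eval_of_tsupport_subset hv').mono le_sup_right le_rfl
  have hbound := abs_integral_mul_le_of_condIndepCondExp hGle0 hXle0 (sup_le hGle0 hYle0) le_sup_left h'
    hXm.stronglyMeasurable.aestronglyMeasurable hYm.stronglyMeasurable hX2 hY2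
  have hGF : G = fieldSigma (Metric.ball (0 : EuclideanSpace ℝ (Fin 3)) (1 + ε) \ Metric.closedBall (0 : EuclideanSpace ℝ (Fin 3)) 1) :=
    sig_eq_fieldSigma _
  have hGle : G ≤ fieldSigma (Metric.thickening ε (Metric.sphere (0 : (EuclideanSpace ℝ (Fin 3))) 1)) := by
    rw [hGF]
    exact fieldSigma_mono (shell_subset_thickening_sphere ε)
  have hmono := integral_condExp_sq_mono hGle (fieldSigma_le _) hX2
  exact hbound.trans (mul_le_mul_of_nonneg_right (Real.sqrt_le_sqrt hmono) (Real.sqrt_nonneg _))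

/-- A test function supported off the closed unit ball is supported off a slightly larger closed
ball (compactness of `B̄(0,1)`). [folklore] -/
theorem exists_tsupport_subset_compl_closedBall {v : 𝓢((EuclideanSpace ℝ (Fin 3)), ℝ)}
    (hv : tsupport ⇑v ⊆ (Metric.closedBall (0 : EuclideanSpace ℝ (Fin 3)) 1)ᶜ) :
    ∃ δ : ℝ, 0 < δ ∧ ∀ ε : ℝ, 0 ≤ ε → ε ≤ δ →
      tsupport ⇑v ⊆ (Metric.closedBall (0 : EuclideanSpace ℝ (Fin 3)) (1 + ε))ᶜ := by
  have hsub : Metric.closedBall (0 : EuclideanSpace ℝ (Fin 3)) 1 ⊆ (tsupport ⇑v)ᶜ :=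
    Set.subset_compl_comm.1 hv
  obtain ⟨δ, hδ, hδsub⟩ := (isCompact_closedBall (0 : EuclideanSpace ℝ (Fin 3)) 1).exists_cthickening_subset_open
    (isClosed_tsupport _).isOpen_compl hsub
  refine ⟨δ, hδ, fun ε hε0 hεδ => Set.subset_compl_comm.1 ?_⟩
  calc Metric.closedBall (0 : EuclideanSpace ℝ (Fin 3)) (1 + ε)
      ⊆ Metric.closedBall (0 : EuclideanSpace ℝ (Fin 3)) (δ + 1) :=
        Metric.closedBall_subset_closedBall (by linarith)
    _ = Metric.cthickening δ (Metric.closedBall (0 : EuclideanSpace ℝ (Fin 3)) 1) :=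
        (cthickening_closedBall hδ.le zero_le_one _).symm
    _ ⊆ (tsupport ⇑v)ᶜ := hδsub

/-- **(D) ⇒ vanishing covariance across the sphere.**  Let `μ` be a centred Gaussian probability law on
`𝒮'(ℝ³)` with two-point function `A · K_Δ` (`K_Δ(u,v) = ∫∫ u(x)‖x−y‖^{-2Δ}v(y)`, `A > 0`,
`1/2 < Δ ≤ 1`), let `w` be supported in the open unit ball with Riesz potential vanishing on the unit
sphere, and assume the decoupling inequality (D_ε) for `w` at every width `ε ∈ (0, ε₀)`:
`|E[ω(w)ω(v)]| ≤ ‖E[ω(w) | 𝒜((∂B)^ε)]‖₂‖ω(v)‖₂` for all `v` supported off `B̄(0, 1+ε)`.  Then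
`E[ω(w)ω(v)] = 0` for every `v` supported off the closed unit ball: by `stub_collar_cutoff` and
`stub_sobolev_riesz_duality` the covariance of `ω(w)` with the field in a thin collar is `η`-small, so
`‖E[ω(w) | 𝒜((∂B)^ε)]‖₂ ≤ η` by the Gaussian bound `stub_gaussian_condExp_sq_le` (all tree theorems; same
argument as `twoPoint_eq_zero_of_germMarkov_ball`). [cite: Rozanov1982, Ch. 3 §2.3 Theorem (p. 115)] -/
theorem twoPoint_eq_zero_of_sphereDecoupling
    {Δ A : ℝ} (hΔ : 1 / 2 < Δ) (hΔ1 : Δ ≤ 1) (hA : 0 < A)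
    {μ : Measure (FieldConfig (EuclideanSpace ℝ (Fin 3)))} [IsProbabilityMeasure μ] (hG : IsGaussianField μ)
    (h2pt : ∀ u v : 𝓢((EuclideanSpace ℝ (Fin 3)), ℝ), twoPoint μ u v = A * ∫ x, ∫ y, u x * ‖x - y‖ ^ (-(2 * Δ)) * v y)
    {w : 𝓢((EuclideanSpace ℝ (Fin 3)), ℝ)} (hw : tsupport ⇑w ⊆ Metric.ball (0 : (EuclideanSpace ℝ (Fin 3))) 1)
    (hws : ∀ x : (EuclideanSpace ℝ (Fin 3)), ‖x‖ = 1 → ∫ y, w y * ‖y - x‖ ^ (-(2 * Δ)) = 0)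
    {ε₀ : ℝ} (hε₀ : 0 < ε₀)
    (hD : ∀ ε : ℝ, 0 < ε → ε < ε₀ → ∀ v : 𝓢((EuclideanSpace ℝ (Fin 3)), ℝ),
      tsupport ⇑v ⊆ (Metric.closedBall (0 : EuclideanSpace ℝ (Fin 3)) (1 + ε))ᶜ →
      |∫ ω, ω w * ω v ∂μ| ≤
        Real.sqrt (∫ ω, (μ[(fun ω : FieldConfig (EuclideanSpace ℝ (Fin 3)) => ω w) |
          fieldSigma (Metric.thickening ε (Metric.sphere (0 : EuclideanSpace ℝ (Fin 3)) 1))]) ω ^ 2 ∂μ) *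
        Real.sqrt (∫ ω, (ω v) ^ 2 ∂μ))
    {v : 𝓢((EuclideanSpace ℝ (Fin 3)), ℝ)} (hv : tsupport ⇑v ⊆ (Metric.closedBall (0 : (EuclideanSpace ℝ (Fin 3))) 1)ᶜ) :
    twoPoint μ w v = 0 := by
  obtain ⟨δ, hδ, hvδ⟩ := exists_tsupport_subset_compl_closedBall hv
  obtain ⟨C, hC, hdual⟩ := stub_sobolev_riesz_duality Δ hΔ hΔ1
  -- for every `η > 0`: `|E[ω w ω v]| ≤ η ‖ω v‖₂`
  have hsmall : ∀ η : ℝ, 0 < η → |∫ ω, ω w * ω v ∂μ| ≤ η * Real.sqrt (∫ ω, (ω v) ^ 2 ∂μ) := by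
    intro η hη
    have hAC : 0 < Real.sqrt A * C := mul_pos (Real.sqrt_pos.2 hA) hC
    set η₅ : ℝ := (η / (Real.sqrt A * C)) ^ 2 with hη₅
    have hη₅pos : 0 < η₅ := by positivity
    obtain ⟨ε, hε, h, hhK, hhnorm⟩ := stub_collar_cutoff Δ hΔ hΔ1 w hw hws η₅ hη₅pos
    -- hypothesis of `stub_gaussian_condExp_sq_le` on the collar of width `ε`
    have hP : ∀ f : 𝓢((EuclideanSpace ℝ (Fin 3)), ℝ), tsupport ⇑f ⊆ Metric.thickening ε (Metric.sphere (0 : (EuclideanSpace ℝ (Fin 3))) 1) →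
        |∫ ω, ω w * ω f ∂μ| ≤ η * Real.sqrt (∫ ω, (ω f) ^ 2 ∂μ) := by
      intro f hf
      have e1 : ∫ ω, ω w * ω f ∂μ = A * ∫ x, h x * f x := by
        rw [← hhK f hf, ← h2pt w f]
        rfl
      have e2 : ∫ ω, (ω f) ^ 2 ∂μ = A * ∫ x, ∫ y, f x * ‖x - y‖ ^ (-(2 * Δ)) * f y := by
        rw [← h2pt f f]
        simp only [twoPoint, sq]
      rw [e1, e2, abs_mul, abs_of_pos hA, Real.sqrt_mul hA.le]
      have hd := hdual h f
      have hs : Real.sqrt ((∫ x, (h x) ^ 2) + ∫ x, ‖fderiv ℝ (⇑h) x‖ ^ 2) ≤ η / (Real.sqrt A * C) := by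
        calc Real.sqrt ((∫ x, (h x) ^ 2) + ∫ x, ‖fderiv ℝ (⇑h) x‖ ^ 2) ≤ Real.sqrt η₅ :=
              Real.sqrt_le_sqrt hhnorm
          _ = η / (Real.sqrt A * C) := by
              rw [hη₅, Real.sqrt_sq (by positivity)]
      calc A * |∫ x, h x * f x|
          ≤ A * (C * Real.sqrt ((∫ x, (h x) ^ 2) + ∫ x, ‖fderiv ℝ (⇑h) x‖ ^ 2) *
              Real.sqrt (∫ x, ∫ y, f x * ‖x - y‖ ^ (-(2 * Δ)) * f y)) :=
            mul_le_mul_of_nonneg_left hd hA.le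
        _ ≤ A * (C * (η / (Real.sqrt A * C)) *
              Real.sqrt (∫ x, ∫ y, f x * ‖x - y‖ ^ (-(2 * Δ)) * f y)) := by
            gcongr
        _ = η * (Real.sqrt A * Real.sqrt (∫ x, ∫ y, f x * ‖x - y‖ ^ (-(2 * Δ)) * f y)) := by
            have hsA : Real.sqrt A ≠ 0 := (Real.sqrt_pos.2 hA).ne'
            have hCne : C ≠ 0 := hC.ne'
            have hdiv : A / Real.sqrt A = Real.sqrt A := Real.div_sqrt
            rw [← hdiv]
            field_simp
            rw [Real.sq_sqrt hA.le]
    -- a width below `ε`, `δ` and `ε₀`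
    set ε' : ℝ := min ε (min δ (ε₀ / 2)) with hε'
    have hε'pos : 0 < ε' := lt_min hε (lt_min hδ (by positivity))
    have hε'ε : ε' ≤ ε := min_le_left _ _
    have hε'δ : ε' ≤ δ := (min_le_right _ _).trans (min_le_left _ _)
    have hε'ε₀ : ε' < ε₀ := lt_of_le_of_lt ((min_le_right _ _).trans (min_le_right _ _)) (by linarith)
    have hDv := hD ε' hε'pos hε'ε₀ v (hvδ ε' hε'pos.le hε'δ)
    have hle : fieldSigma (Metric.thickening ε' (Metric.sphere (0 : (EuclideanSpace ℝ (Fin 3))) 1)) ≤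
        fieldSigma (Metric.thickening ε (Metric.sphere (0 : (EuclideanSpace ℝ (Fin 3))) 1)) :=
      fieldSigma_mono (Metric.thickening_mono hε'ε _)
    have h31 := stub_gaussian_condExp_sq_le μ hG
      (Metric.thickening ε (Metric.sphere (0 : (EuclideanSpace ℝ (Fin 3))) 1)) w η hη.le hP _ hle
    have hsq : Real.sqrt (∫ ω, (μ[(fun ω : FieldConfig (EuclideanSpace ℝ (Fin 3)) => ω w) |
        fieldSigma (Metric.thickening ε' (Metric.sphere (0 : (EuclideanSpace ℝ (Fin 3))) 1))]) ω ^ 2 ∂μ) ≤ η :=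
      calc Real.sqrt (∫ ω, (μ[(fun ω : FieldConfig (EuclideanSpace ℝ (Fin 3)) => ω w) |
              fieldSigma (Metric.thickening ε' (Metric.sphere (0 : (EuclideanSpace ℝ (Fin 3))) 1))]) ω ^ 2 ∂μ)
          ≤ Real.sqrt (η ^ 2) := Real.sqrt_le_sqrt h31
        _ = η := Real.sqrt_sq hη.le
    exact hDv.trans (mul_le_mul_of_nonneg_right hsq (Real.sqrt_nonneg _))
  -- conclude
  have habs : |∫ ω, ω w * ω v ∂μ| = 0 :=
    eq_zero_of_forall_le_mul (b := Real.sqrt (∫ ω, (ω v) ^ 2 ∂μ)) (abs_nonneg _) hsmall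
  have : ∫ ω, ω w * ω v ∂μ = 0 := abs_eq_zero.1 habs
  simpa [twoPoint] using this

/-- **Registered form (crux stmt-CriticalPhenomena-2601, line `registered`, skeleton v10; sub-goal of the
glue): (D) across the unit sphere ⇒ the covariance across the sphere vanishes** — see
`twoPoint_eq_zero_of_sphereDecoupling` (all arguments explicit). [cite: Rozanov1982, Ch. 3 §2.3 Theorem (p. 115)] -/
theorem stub_sphereCovarianceZero_of_decoupling :
    ∀ (Δ A : ℝ) (μ : MeasureTheory.Measure (Literature.MathematicalPhysics.QuantumLattice.FieldConfig (EuclideanSpace ℝ (Fin 3)))) [MeasureTheory.IsProbabilityMeasure μ], 1 / 2 < Δ → Δ ≤ 1 → 0 < A → Literature.MathematicalPhysics.QuantumLattice.IsGaussianField μ → (∀ u v : SchwartzMap (EuclideanSpace ℝ (Fin 3)) ℝ, Literature.MathematicalPhysics.QuantumLattice.twoPoint μ u v = A * ∫ x, ∫ y, u x * ‖x - y‖ ^ (-(2 * Δ)) * v y) → ∀ (w : SchwartzMap (EuclideanSpace ℝ (Fin 3)) ℝ), tsupport ⇑w ⊆ Metric.ball (0 : EuclideanSpace ℝ (Fin 3))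 1 → (∀ x : EuclideanSpace ℝ (Fin 3), ‖x‖ = 1 → ∫ y, w y * ‖y - x‖ ^ (-(2 * Δ)) = 0) → ∀ (ε₀ : ℝ), 0 < ε₀ → (∀ ε : ℝ, 0 < ε → ε < ε₀ → ∀ v : SchwartzMap (EuclideanSpace ℝ (Fin 3)) ℝ, tsupport ⇑v ⊆ (Metric.closedBall (0 : EuclideanSpace ℝ (Fin 3)) (1 + ε))ᶜ → |∫ ω, ω w * ω v ∂μ| ≤ Real.sqrt (∫ ω, (MeasureTheory.condExp (Literature.MathematicalPhysics.QuantumLattice.fieldSigma (Metric.thickening ε (Metric.sphere (0 : EuclideanSpace ℝ (Fin 3)) 1))) μ (fun ω : Literature.MathematicalPhysics.QuantumLattice.FieldConfig (EuclideanSpace ℝ (Fin 3)) => ω w)) ω ^ 2 ∂μ) * Real.sqrt (∫ ω, (ω v) ^ 2 ∂μ)) → ∀ (v : SchwartzMap (EuclideanSpace ℝ (Fin 3)) ℝ), tsupport ⇑v ⊆ (Metric.closedBall (0 : EuclideanSpace ℝ (Fin 3)) 1)ᶜ → Literature.MathematicalPhysics.QuantumLattice.twoPoint μ w v = 0 :=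 by
  intro Δ A μ _ hΔ hΔ1 hA hG h2pt w hw hws ε₀ hε₀ hD v hv
  exact twoPoint_eq_zero_of_sphereDecoupling hΔ hΔ1 hA hG h2pt hw hws hε₀ hD hv

end Field

end Summit.CriticalPhenomena.Ising3DConformalLimit.Cruxes.GaussianLimitIsFree.Birth

end
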